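import Summits.BirchSwinnertonDyer.Rank1Residual.Additive.ShaGrowthDichotomyThree
import HarnessLib

/-!
# `CompanionLambdaShiftThreePW` — the companion `λ`-law at a wild additive `3` in Pollack–Weston's
# SHIFTED form: layer `k + 1` of `W` against layer `k` of its good companion `A`
# (o6-r1 GEN 6 FREEZE A-O6-T6 for cc-typer-5; cell `b2b-bsdres`, lane CLASS-CLOSURE, E3 transport;
# TYPED, EVIDENCE-LABELLED, NOTHING ASSERTED; successor of — not a rewording of — `CompanionLambdaShiftThree`)

HONEST FRAMING (cell `b2b-bsdres`, verbatim in every file): the goal of the cell is to DELETE the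
COMBINATION-SHAPED residual classes of the Birch–Swinnerton-Dyer formula for ALL analytic-rank `≤ 1`
elliptic curves over `ℚ` — "full BSD formula for every rank `≤ 1` curve in class `C`" assembled
STRICTLY from published theorems — so that the rank-`≤ 1` remainder becomes exactly the
CONSTRUCTION-SHAPED classes, which are TYPED (missing-input `Prop`s), NOT attempted. This is not
"finishing BSD". Lane CLASS-CLOSURE: census output is EVIDENCE / conjecture items with held-out
validation, never a Literature fact; no main conjecture inside any certificate; nothing is booked; no
mark of `RESIDUAL-MAP.md` moves. 0 named Literature facts here: one `@[conjecture]` EVIDENCE item and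
proved arithmetic of the templates.

## What the census decided (o6-r1 GEN 6, test V6-C, PRE-REGISTERED 2026-08-21T10:20Z before any
## companion-side number existed; kit j129939, script `gen6/v6c/job/main.py` 2dd2bec2be211f8d,
## cell table `cells.tsv` e7937e705ff78dbf, report a6ebc4473826206d; inputs cc-eng-3 A-ENG3-4
## 9f72651bfd44b26d (θ_k of the 1 808 partner classes, two engines identical 10 925/10 925) and
## A-ENG3-3 PART A links 88206fbfe2d9f053)

UNIVERSE: every O6 row `W` (`v₃(N_W) ≥ 3`, potentially supersingular, `LocIrr W 3`) with a RATIONAL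
good companion `A` of level `M ∣ N_W/27` (`IsCompanionThree`): 3 153 (row, companion-class) links =
1 647 rows × 1 775 classes, ALL with `v₃(Δ_W) = 9` (none of the 737 `v₃(Δ) = 3` O6-FW rows has a
weight-`2` ELLIPTIC companion of level prime to `3` in the table range — consistent with Serre weight
`≠ 2` there, NOT verified, non-rational weight-`2` companions not searched; so the `v₃(Δ) = 3` clause of
the template is UNTESTED and, within `IsCompanionThree`, possibly vacuous). Companions: `a₃(A) = 0` on 1 889, `a₃(A) = ±3` on 1 001 of the decisive cells; ranks
`(r_W, r_A) ∈ {0,1} × {0,1,2}` all populated; `N_W ≤ 499 824`, `26 ≤ N_A ≤ 18 512`.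

(1) SHIFTED LAW (this file) — `λ(θ_{k}(W)) = λ(θ_{k−1}(A)) + 2·3^{k−1} + EPW_k(W, A)` with
`EPW_k = Σ_{ℓ ∣ N_W N_A, ℓ ≠ 3} (e_ℓ^{(k)}(A) − e_ℓ^{(k)}(W))`, `e_ℓ^{(k)} = m_ℓ · 3^{min(v₃(ℓ²−1)−1, k)}`
(`m_ℓ` = multiplicity of the eigenvalue `1` of Frobenius / the unit root on the `ℓ`-Euler factor mod `3`;
Emerton–Pollack–Weston): residual EXACTLY `0` on 3 153 / 3 153 links at `k = 6` (2 890 scored cells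
with irreducible `W[3]`-image and no double eigenvalue — the pre-registered decisive set, PASS needs
`0` violations and `≥ 100` cells —, 261 double-eigenvalue cells, 2 reducible-image cells), on
3 151 / 3 151 at `k = 5`, 3 146 / 3 146 at `k = 4`, 2 728 / 2 728 at `k = 3`, 795 / 795 at `k = 2`:
12 973 scored cells, 0 exceptions; `EPW_6 ≠ 0` on 1 257 of the 2 890 decisive cells (values
`−9 … 9` and one `81`), so the local term is exercised, not idle. In template language (the tree's
`signedBase 9 (k+1) − kuriharaQ k = 2·3^k`, `signedBase 3 (k+1) − kuriharaQ k = 3^k`, proved below):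
`[λ(θ_{k+1}(W)) − template_W(k+1)] − [λ(θ_k(A)) − template_A(k)] = EPW` — ONE constant, no parity.

(2) SAME-LAYER VALUE CLAUSE of `CompanionLambdaShiftThree`'s docstring ("PREDICTED … `s₀ = s₁` = EPW
sum") — REFUTED AS AN EXACT LAW: 1 380 / 2 890 decisive cells violate it at `k = 6` (1 492 / 3 153
links); the residual is EXACTLY `ρ_{k−1}(A) − ρ_k(A)` (`ρ_k(A) := λ(θ_k(A)) − q_k`, Kurihara's
`λ^{ε_k}`-alternation) on 3 153 / 3 153, i.e. `±(λ⁺(A) − λ⁻(A)) ∈ {±2, …, ±12}` exactly on the companions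
with `λ⁺ ≠ λ⁻`. The TYPED statement `CompanionLambdaShiftThree` (`∃ s₀ s₁`, `2`-periodic) SURVIVES:
`R(6) = R(4)` on 3 151 / 3 151 cells (`R(5) = R(3)` on 2 343 / 2 382; `k = 3` is below the decision
layers). Per the pre-registered read rule R1 the successor is THIS decl (new name; the landed decl is
not reworded; its docstring value clause gets an erratum banner pointing here).

(3) NOT DECIDED here (honest scope): the reducible branch `¬LocIrr W 3` — all 289 ordinary-companion
links of O6 have GLOBALLY reducible `W[3]` (images 3B.x / 3Cs.x: outside `HasIrreducibleModPGaloisRep`,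
the Greenberg–Vatsal reducible regime, and 211 of them have `μ(θ_k(A)) = −1`: `3θ_k(A) ≡ u·ν_k`, the
`3`-torsion Eisenstein congruence); descriptively the Kodaira-IV* (`v₃Δ = 9`) rows follow
`λ_k(W) = φ(3^k) + λ(A) + EPW` (slope `1`, offset `0`: 6 / 6 scored cells) and the type-II (`v₃Δ = 3`)
rows have `λ_k(W) = 3^{k−1}` regardless of the companion (47 / 52 cells off the PW shape). The
ELEMENT-level identity `θ̄_{k}(W)·∏E_ℓ(W) = ±T^{2·3^{k−1}}·θ̄_{k−1}(A)·∏E_ℓ(A)` in `𝔽₃[T]/(T^{3^k})`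
(exploratory, convention chosen on 2/3 of the rows, validated on the held-out third) is FALSE as an
identity: held-out matches 1 / 904 at `k = 6`, 3 / 903 at `k = 5` (the `λ`-law holds, the unit does
not trivialise) — recorded so nobody types it.

KILL (pre-declared for the successor): one (row, companion) pair inside the hypotheses with both
`μ = 0`, unsaturated `λ` (`λ(θ_{k+1}(W)) < 3^{k+1} − 1`), `k ≥ max_ℓ v₃(ℓ²−1)` (stable local terms), and
`[λ(θ_{k+1}(W)) − template_W(k+1)] − [λ(θ_k(A)) − template_A(k)]` taking two different values at two
such layers. PREDICTED value of `s` (docstring only, not typed): the stable EPW sum.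

## TYPER PLACEMENT NOTE (cc-typer-5 GEN 4, typer of record O5 §3.5 / O6 §3.4, 2026-08-21)
Landed from o6-r1 GEN 6's file `HOME/b2b-bsdres-o6-r1/gen6/CompanionLambdaShiftThreePW.lean` (sha16
f21b9227c4c178b3, the 10:49Z doc-softened successor of 4d707ee363351564) VERBATIM below this note (ASK
A-O6-T6 (a)). SUPERSEDE, NEVER RE-WORD IN PLACE: `CompanionLambdaShiftThree` (p259222) keeps its
statement (its typed 2-periodic form SURVIVES V6-C: R(6) = R(4) on 3 151/3 151); only the PREDICTED-VALUE
sentence of its docstring is refuted as an exact law and gets an ERRATUM banner (A-O6-T6 (b), doc-only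
re-land of `Additive/ShaGrowthDichotomyThree.lean`, same proposal batch) pointing to THIS node, the
one-constant SHIFTED form. DEDUP STANCE (typer of record): this is now the FOURTH typed formulation of the
'λ-transport along a mod-3 congruence' mechanism (T11 `O5.CongruenceTransportLawThree` on O5b pairs;
(G3-15) `Additive.MazurTateLambdaCongruenceThree branch` off O5b; `CompanionLambdaShiftThree` and this
`…PW` with a GOOD-at-3 partner; plus o5-r1's T13/T14 on the depleted elements) — all kept as SIBLINGS
(different binders / templates), none merged; the subsuming 'all-local-types λ-transport' node is typed
when somebody states it. TYPER CHECK: binders = `CompanionLambdaShiftThree`'s + `LocIrr W 3` + explicit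
newforms `fW`, `fA` with `IsScaledMazurTateLift` at layers `k+1` / `k` and `μ`-readings `mW`, `mA` — no
hidden hypothesis; the `v₃Δ_W = 3` branch of the template is declared UNTESTED by its author (0/737 rows
have an elliptic weight-2 prime-to-3 companion). Audit marks expected: `conjecture` 1, `orphan` 3 (proved
template arithmetic). 0 named Literature facts; census items, never Literature facts; nothing booked; no
mark of `RESIDUAL-MAP.md` moves.
-/

open scoped Classical MatrixGroups ModularForm NumberField

open CongruenceSubgroup Polynomial WeierstrassCurve NumberField Literature.NumberTheory.EllipticCurves
  Literature.NumberTheory.EllipticCurves.ModularForms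
  Literature.NumberTheory.EllipticCurves.Rank1Residual
  Literature.NumberTheory.EllipticCurves.Rank1Residual.Typed
  Summit.BirchSwinnertonDyer.Rank1Residual.X1.MuLambda

namespace Summit.BirchSwinnertonDyer.Rank1Residual.Additive

/-! ## §1 The shifted companion law (CONJECTURE; EVIDENCE-labelled) -/

/-- **`CompanionLambdaShiftThreePW` (CONJECTURE; EVIDENCE-labelled; o6-r1 GEN 6 FREEZE A-O6-T6) —
Pollack–Weston's Theorem 1 (`λ(θ_n(f)) = pⁿ − pⁿ⁻¹ + q_{n−1} + λ^{−ε_n}(g)` for `ρ̄_f|G_{ℚ_p}`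
irreducible) transplanted from "weight `k > 2`, level prime to `p`" to "weight `2`, `27 ∣ N`", with
the Emerton–Pollack–Weston local terms for the level change `N_W ↝ N_A`.** For `W/ℚ` additive at `3`
with `f₃ ≥ 2`, potentially supersingular (`v₃(j) > 0 ∨ j = 0`), `W[3]` irreducible and `W[3]|G_{ℚ₃}`
irreducible (`LocIrr W 3`), and a companion `A` (good at `3`, `A[3] ≅ W[3]`, hence supersingular at
`3`): there are an INTEGER `s` and `k₀` such that for every `k ≥ k₀` at which `θ_{k+1}(W)` and
`θ_k(A)` both have `μ = 0`,
`[λ(θ_{k+1}(W)) − template_W(k+1)] − [λ(θ_k(A)) − template_A(k)] = s`,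
i.e. `λ(θ_{k+1}(W)) − λ(θ_k(A)) = 2·3^k + s` (`v₃Δ_W = 9`) resp. `3^k + s` (`v₃Δ_W = 3`, untested).
EVIDENCE (module docstring (1)): 12 973 / 12 973 cells, `k = 2 … 6`, 3 153 links, kit j129939.
PREDICTED (not typed): `s` = the stable EPW sum `Σ_{ℓ ≠ 3} (e_ℓ(A) − e_ℓ(W))`.
[cite: PollackWeston2011MT, Thm. 1] [cite: EmertonPollackWeston2006, Thm. 1] [cite: Kurihara2002, Thm. 0.1] -/
@[conjecture] def CompanionLambdaShiftThreePW : Prop :=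
  ∀ (W A : WeierstrassCurve ℚ) [W.IsElliptic] [W.IsGloballyMinimal] [A.IsElliptic]
    [A.IsGloballyMinimal] [NeZero (W.conductorNorm ℤ)] [NeZero (A.conductorNorm ℤ)]
    (fW : CuspForm (Gamma0 (W.conductorNorm ℤ)) 2) (fA : CuspForm (Gamma0 (A.conductorNorm ℤ)) 2),
    IsNewformOf W fW → IsNewformOf A fA → Addv W 3 → 2 ≤ condExp W 3 →
    (0 < padicValRat 3 W.j ∨ W.j = 0) → W.HasIrreducibleModPGaloisRep 3 → LocIrr W 3 →
    IsCompanionThree W A →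
    ∃ (s : ℤ) (k₀ : ℕ), ∀ (k mW mA : ℕ) (ΘW ΘA : IwasawaAlgebra 3), k₀ ≤ k →
      O5.IsScaledMazurTateLift fW (k + 1) mW ΘW → ΘW ≠ 0 → mu ΘW = mW →
      O5.IsScaledMazurTateLift fA k mA ΘA → ΘA ≠ 0 → mu ΘA = mA →
      ((lam ΘW : ℚ) - mtTemplateThree W 0 (k + 1)) - ((lam ΘA : ℚ) - companionTemplateThree A k) = s

/-! ## §2 Kernel sanity (PROVED; nothing conjectural): the shift constant of the templates -/

/-- The template shift between layer `k + 1` of `W` and layer `k` of a supersingular companion is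
`2·3^k` at `v₃Δ = 9` and `3^k` otherwise: `signedBase v (k+1) − q_k = (2 ∣ 1)·3^k` — Pollack–Weston's
`pⁿ − pⁿ⁻¹` at `p = 3` (resp. its half). [folklore] -/
theorem signedBase_succ_sub_kuriharaQ (v k : ℕ) :
    signedBase v (k + 1) - O5.kuriharaQ k = (if v = 9 then 2 else 1) * 3 ^ k := by
  simp [signedBase]

/-- On the irreducible branch with a supersingular companion the two templates differ by exactly the
shift constant: `template_W(k+1) − template_A(k) = (2 ∣ 1)·3^k` (any slope argument `L`; it is unused
on this branch). [folklore] -/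
theorem mtTemplateThree_succ_sub_companionTemplateThree (W A : WeierstrassCurve ℚ) [W.IsElliptic]
    [W.IsGloballyMinimal] [A.IsGloballyMinimal] (L : ℚ) (k : ℕ) (hW : LocIrr W 3)
    (hA : (3 : ℤ) ∣ A.frobeniusTrace 3) :
    mtTemplateThree W L (k + 1) - companionTemplateThree A k =
      ((if padicValInt 3 W.minimalDiscriminantInt = 9 then 2 else 1) * 3 ^ k : ℕ) := by
  have h := signedBase_succ_sub_kuriharaQ (padicValInt 3 W.minimalDiscriminantInt) k
  have hle : O5.kuriharaQ k ≤ signedBase (padicValInt 3 W.minimalDiscriminantInt) (k + 1) := by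
    simp [signedBase]
  simp only [mtTemplateThree, companionTemplateThree, hW, hA, if_true]
  have := Nat.sub_eq_iff_eq_add hle |>.mp h
  rw [this]; push_cast; ring

/-- Numerical instances at the census layers `k = 1 … 5` (`W` at layers `2 … 6`):
`signedBase 9 (k+1) − q_k = 6, 18, 54, 162, 486` and `signedBase 3 (k+1) − q_k = 3, 9, 27, 81, 243`.
[folklore] -/
theorem signedBase_succ_sub_kuriharaQ_values :
    signedBase 9 2 - O5.kuriharaQ 1 = 6 ∧ signedBase 9 3 - O5.kuriharaQ 2 = 18 ∧
      signedBase 9 4 - O5.kuriharaQ 3 = 54 ∧ signedBase 9 5 - O5.kuriharaQ 4 = 162 ∧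
      signedBase 9 6 - O5.kuriharaQ 5 = 486 ∧ signedBase 3 2 - O5.kuriharaQ 1 = 3 ∧
      signedBase 3 4 - O5.kuriharaQ 3 = 27 ∧ signedBase 3 6 - O5.kuriharaQ 5 = 243 := by
  simp [signedBase, O5.kuriharaQ]

end Summit.BirchSwinnertonDyer.Rank1Residual.Additive
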